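/-
Copyright (c) 2026 the pub-hodgecm-mathlib formalisation cell (harness21).  Prover seat hodgecm-mathlib-LH4-p16 (g0), req620 Track A «(D-RAM) FOUR-FRAME» squad
(STAGE-1b, row (2) of the piece `f_{T₊}`, the (β₂) road; director s1968 EMIT «p16 = β₂ specific-cell class (M4)»; heir LEAD T20-16 (R-35); β₂-face sub-dealer LH4-p04 (g8),
face geometer LH4-p09 (g9), SIG-FaceTube v1 f2b012b1 «=» 14:59:44Z), 2026-09-04.
-/
import Summits.HodgeConjecture.HodgeConjecture.Theorems.F0P3cDyRamConeCellFaceTube   -- ★ FILE I (this seat): §1 weighted exchange engine, `exists_fixed_unit_weight_eq_natCard_normFibre`; brings ★ p860971, ★ p860839, ★ p860765, ★ `…ConeWeightHalfSplit`, ★ T1, ★ DEFS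
import HarnessLib

/-!
# Crux `H413`, line LH4 «(D-RAM) FOUR-FRAME» — STAGE-1b, row (2), the (β₂) road, brick (β₂-H) class (M4): «THE β₂ FACE ON TUBE CELLS» II — AT AND ABOVE THE GLUE CONDUCTOR
# `d ≤ b`: the weighted face is the POPULATED sub-cell's balance (socket for the near-similitude torus flip), and the exact ω-flip is populatedness-REVERSING there

Cell `hodgecm-mathlib` (D-0151), FLOOR 0, crux item H413 = `stmt-HodgeConjecture-24833`, route of record `HCCMUnconditional`; squad F0∕P3c∕LH4; lane
`--supports stmt-HodgeConjecture-24833 --as helper` (count-neutral; pays NO tier-0 row).  THEOREMS ONLY (no `def`, no instance, no notation, no `sorry`, default heartbeats).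
Frame = ★ FILE I §3's = ★ `ConeWeightHalfSplit.finsum_levelSetDep_weight_eq_pow_mul_ncard`'s (E-side wild datum of ★ T1, `E` complete, line model, ★ (C1)'s weight letter `hf` VERBATIM).

WHY (continuing ★ FILE I).  On a tube cell `(j, b)` of the type-(2) cone the (β₂-H) face is the WEIGHTED exchange balance `Σᶠ_{cell ∩ {+}} f b j = Σᶠ_{cell ∩ {−′}} f b j`,
`f b j Λ = #Sol_{2b}(r_Λ)`.  AT AND ABOVE the glue conductor (`d ≤ b`) ★ T1 is norm-gated: `#Sol_{2b}(r) = 2q^b` if the `σ`-fixed unit `r` is a norm and `0` if not.  Hence: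
* §1 (abstract) a two-valued weight `w ∈ {c, 0}` counts its support (`Σᶠ_{S ∩ {P}} w = c·#{S ∣ P ∧ w ≠ 0}`), and THE SOCKET: a cell symmetry `τ` preserving `{w ≠ 0}` and exchanging
  the labels gives `Σᶠ_{S ∩ {P}} w = Σᶠ_{S ∩ {Q}} w` (`finsum_mem_inter_eq_of_equiv_exchange_of_eq_or_eq_zero`; a two-valued weight whose support is `τ`-stable is `τ`-invariant, so ★
  FILE I `finsum_mem_inter_eq_of_equiv_exchange` applies).
* §2 `weight_eq_two_mul_pow_or_eq_zero_of_le` (`f b j Λ ∈ {2q^b, 0}` on the cell, ★ T1 at the canonical cone datum of ★ FILE I); `finsum_levelSetDep_inter_weight_eq_two_mul_pow_mul_ncard_of_le`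
  (`Σᶠ_{cell ∩ {P}} f = 2q^b·#{cell ∣ P ∧ f ≠ 0}`); HEAD-hi `finsum_levelSetDep_inter_weight_eq_iff_of_le` — the weighted face ⟺ the UNWEIGHTED balance of the POPULATED
  sub-cell; SOCKET-hi `finsum_levelSetDep_inter_weight_eq_of_popPreserving_exchange_of_le` — any cell-preserving `τ : AddSubgroup M ≃ AddSubgroup M` that preserves populatedness
  (`f (τ Λ) ≠ 0 ↔ f Λ ≠ 0`) and exchanges the labels closes the weighted face at `d ≤ b`.  The intended `τ` is the NEAR-SIMILITUDE torus flip of F0P3-p01 (g36)'s HP-WITNESS-TABLE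
  v1 5cca8016 (rows `a₂ ≥ 2d`, e.g. `ε = 1+(3+i)ω`, `ν = ε·Θε ≡ 11 mod ϖ⁸`, `ν ∉ F`): cell-preservation = LH4-p09 (g9)'s ED. 2 of ★ p860839 `smul_mem_levelSetDep_iff_of_orderUnit` (ν a unit
  of the order, `ρν = ν` NOT assumed); populatedness- and label-transport of such `ε` (the glue unit moves by `Tr_ρ(T·ρν)∕(Tr_ρ T·N_ρ ν)`, not by `ν⁻¹`) are OPEN and NOT claimed here.
* §3 TIGHTNESS `weight_smul_ne_zero_iff_weight_eq_zero_of_le`: for the EXACT ω-flip `z` of ★ `ConeWeightHalfSplit` (`|z| = 1`, `z·Θz = jE ξ`, `ξ` a `σ`-fixed NON-norm of `E`) and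
  `Λ` in the cell, `f b j (z • Λ) ≠ 0 ↔ f b j Λ = 0` (★ `ConeWeightHalfSplit`'s `hpair` read per `Λ`: the glue unit `r₀` goes to `r₀∕ξ`, ★ `glueUnit_mul_left`, and exactly one of
  `r₀`, `r₀∕ξ` is a norm, ★ `isNorm_iff_not_isNorm_div`) — so the exact ω-flip is populatedness-REVERSING at `d ≤ b` (LH4-p09 (g9) 14:43:32Z caveat, now a theorem) and must NOT
  be plugged into SOCKET-hi; what an exact ω-face gives there is `#{cell ∣ P₁ ∧ pop} = #{cell ∣ Q₁ ∧ ¬pop}` (`ncard_sep_pop_eq_ncard_sep_unpop_of_flip_exchange_of_le`), not the balance.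
  (EVIDENCE, numerics only: HP-WITNESS-TABLE (W1)–(W3) are admissible on NO cell with `a₂ ≥ 2d`; the flips found there are near-similitudes.)
HONEST LABEL.  Count-neutral lattice ∕ norm bookkeeping; nothing printed is asserted; no census law is stated; (β₂) stays a HYPOTHESIS and the (β₂-H) face ∕ the populated-subcell
symmetry are taken as hypotheses; `HC_CM` is proved only modulo the 7 printed citations (2 remaining named inputs: hLiu418 = `stmt-HodgeConjecture-24832`, h413 =
`stmt-HodgeConjecture-24833`) until rung 0 closes.
## References
* [Kottwitz1986BaseChangeUnits] R. E. Kottwitz, *Base change for unit elements of Hecke algebras*, Compositio Math. 60 (1986), §1 pp. 240–241 (fixed-lattice counts as orbital integrals).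
* [Rogawski1990] J. D. Rogawski, *Automorphic Representations of Unitary Groups in Three Variables*, Ann. of Math. Stud. 123 (1990), §4.9 Prop. 4.9.1 (b) p. 55 (the labelled census of `f_{T₊}`).
* [Serre1979] J.-P. Serre, *Local Fields*, GTM 67 (1979), Ch. V §3 Prop. 5, Cor. 2–3 pp. 84–86 (norm groups of a ramified quadratic extension; index two).
* [LabesseLanglands1979] J.-P. Labesse, R. P. Langlands, *L-indistinguishability for SL(2)*, Canad. J. Math. 31 (1979), §2 p. 8 (the norm-residue dichotomy).
* [Jacobowitz1962] R. Jacobowitz, *Hermitian forms over local fields*, Amer. J. Math. 84 (1962), §4 (dual lattices, gluing of modular components).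
-/

set_option autoImplicit false

noncomputable section

open scoped Pointwise Valued WithZero Matrix MatrixGroups
open WithZero
open scoped Classical
open Literature.NumberTheory.Automorphic Literature.NumberTheory.Automorphic.HermitianLattice Literature.NumberTheory.Automorphic.UnitaryLatticeTree
open Literature.NumberTheory.Automorphic.UnitaryThreeFourFrame (IsRamifiedQuadraticDatum)
open Literature.NumberTheory.Automorphic.EllipticPlaneAsFieldLine
open Literature.NumberTheory.LocalFields.QuadraticOrder
open Literature.NumberTheory.LocalFields.WildQuadraticDatum
open Summit.HodgeConjecture.HodgeConjecture.Cruxes.H413.F0P3cDyRamToricCensusDefs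
open Summit.HodgeConjecture.HodgeConjecture.Cruxes.H413.F0P3cDyRamConeLevelTransport
open Summit.HodgeConjecture.HodgeConjecture.Cruxes.H413.F0P3cDyRamConeCellLabelBalance (pointwise_smul_eq_map_mulLeft ncard_sep_eq_ncard_sep_of_equiv)
open Summit.HodgeConjecture.HodgeConjecture.Cruxes.H413.F0P3cDyRamConeWeightHalfSplit
open Summit.HodgeConjecture.HodgeConjecture.Cruxes.H413.F0P3cDyRamConeCellFlipBalance
open Summit.HodgeConjecture.HodgeConjecture.Cruxes.H413.F0P3cDyRamConeCellFaceTube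

namespace Summit.HodgeConjecture.HodgeConjecture.Cruxes.H413.F0P3cDyRamConeCellFaceTubeAbove

/-! ## §1 Abstract: a two-valued weight counts its support; THE SOCKET — a support-preserving label-exchanging cell symmetry -/

section Abstract

variable {X : Type*}

/-- **A WEIGHT WITH VALUES IN `{c, 0}` COUNTS ITS SUPPORT**: if `w x = c ∨ w x = 0` on `S` then `Σᶠ_{x ∈ S ∩ {P}} w x = c·#{x ∈ S ∣ P x ∧ w x ≠ 0}`.
[cite: Kottwitz1986BaseChangeUnits, §1 pp. 240–241] -/
theorem finsum_mem_inter_eq_mul_ncard_of_eq_or_eq_zero (S : Set X) (w : X → ℕ) (c : ℕ) (hw : ∀ x ∈ S, w x = c ∨ w x = 0) (P : X → Prop) :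
    ∑ᶠ x ∈ S ∩ {x | P x}, w x = c * {x ∈ S | P x ∧ w x ≠ 0}.ncard := by
  rw [← finsum_mem_inter_support w (S ∩ {x | P x})]
  have hset : S ∩ {x | P x} ∩ Function.support w = {x ∈ S | P x ∧ w x ≠ 0} := by
    ext x; simp only [Set.mem_inter_iff, Set.mem_setOf_eq, Function.mem_support, and_assoc]
  rw [hset, ← finsum_mem_const_eq_mul_ncard]
  refine finsum_mem_congr rfl fun x hx => ?_
  exact (hw x hx.1).resolve_right hx.2.2

/-- **THE SOCKET — A TWO-VALUED WEIGHT IS BALANCED BY ANY SUPPORT-PRESERVING LABEL-EXCHANGING CELL SYMMETRY.**  If `w ∈ {c, 0}` on `S`, `τ : X ≃ X` preserves `S` and the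
support of `w` on `S` (`w (τ x) ≠ 0 ↔ w x ≠ 0`), and exchanges the labels (`P x → Q (τ x)`, `Q y → P (τ⁻¹ y)` on `S`), then `Σᶠ_{S ∩ {P}} w = Σᶠ_{S ∩ {Q}} w` (such a `w` is
`τ`-invariant on `S`; ★ FILE I `finsum_mem_inter_eq_of_equiv_exchange`). [cite: Kottwitz1986BaseChangeUnits, §1 pp. 240–241] -/
theorem finsum_mem_inter_eq_of_equiv_exchange_of_eq_or_eq_zero (S : Set X) (τ : X ≃ X) (hτ : ∀ x, τ x ∈ S ↔ x ∈ S) (w : X → ℕ) (c : ℕ)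
    (hw : ∀ x ∈ S, w x = c ∨ w x = 0) (hpop : ∀ x ∈ S, w (τ x) ≠ 0 ↔ w x ≠ 0) (P Q : X → Prop)
    (hPQ : ∀ x ∈ S, P x → Q (τ x)) (hQP : ∀ y ∈ S, Q y → P (τ.symm y)) :
    ∑ᶠ x ∈ S ∩ {x | P x}, w x = ∑ᶠ x ∈ S ∩ {x | Q x}, w x := by
  refine finsum_mem_inter_eq_of_equiv_exchange S τ hτ w (fun x hx => ?_) P Q hPQ hQP
  have hτx : τ x ∈ S := (hτ x).2 hx
  rcases hw x hx with h1 | h0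
  · rcases hw (τ x) hτx with h1' | h0'
    · rw [h1, h1']
    · by_cases hc : c = 0
      · rw [h0', h1, hc]
      · exact absurd h0' ((hpop x hx).2 (by rw [h1]; exact hc))
  · rw [h0]
    by_contra hne
    exact ((hpop x hx).1 hne) h0

end Abstract

/-! ## §2 (M4-hi) At and above the glue conductor `d ≤ b`: the weight is `2q^b` or `0`; the weighted face is the populated sub-cell's balance; the socket -/

section Weight

variable {E : Type} {M : Type*} [Field E] [Valued E ℤᵐ⁰] [Field M] [Valued M ℤᵐ⁰] {ρ Θ : M →+* M} {α : M}

/-- **(M4-hi) AT AND ABOVE THE CONDUCTOR THE GLUE WEIGHT IS `2q^b` OR `0`** on every `Λ ∈ levelSetDep(j, b; lam − jE u)` (`1 ≤ b`, `d ≤ b`, `E` complete; ★ T1 norm-gated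
`natCard_normFibre_eq_two_mul_pow_of_exists` ∕ `…_eq_zero_of_not_exists_of_le` at the cell member's canonical cone datum). [cite: Serre1979, Ch. V §3 Prop. 5, Cor. 2–3 pp. 84–86]
[cite: LabesseLanglands1979, §2 p. 8] [cite: Kottwitz1986BaseChangeUnits, §1 pp. 240–241] -/
theorem weight_eq_two_mul_pow_or_eq_zero_of_le [CompleteSpace E] [IsDiscreteValuationRing 𝒪[E]] [Finite 𝓀[E]]
    (σ : E →+* E) (hσ : ∀ a, σ (σ a) = a) (hvσ : ∀ a, Valued.v (σ a) = Valued.v a)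
    {ϖ : E} (hϖ : Valued.v ϖ = WithZero.exp (-1 : ℤ)) {d t : ℕ} (hD : IsRamifiedQuadraticDatum σ ϖ d t) (h2v : Valued.v (2 : E) < 1)
    {H₂ : Matrix (Fin 2) (Fin 2) E} (hH₂σ : (H₂.map σ)ᵀ = H₂) {hW : E} (hhW : Valued.v hW = 1) (hhWσ : σ hW = hW) (jE : E →+* M)
    (hρρ : ∀ x, ρ (ρ x) = x) (hvρ : ∀ x, Valued.v (ρ x) = Valued.v x) (hα : ρ α ≠ α) (hα1 : Valued.v α ≤ 1)
    (hint : ∀ z : M, Valued.v z ≤ 1 → Valued.v ((z - ρ z) / (α - ρ α)) ≤ 1)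
    (hΘΘ : ∀ x, Θ (Θ x) = x) (hΘρ : ∀ x, Θ (ρ x) = ρ (Θ x)) (hvΘ : ∀ x, Valued.v (Θ x) = Valued.v x) (hΘj : ∀ x, Θ (jE x) = jE (σ x))
    (hjv : ∀ c, Valued.v (jE c) ≤ 1 ↔ Valued.v c ≤ 1) (hjfix : ∀ z, ρ z = z ↔ ∃ c, jE c = z)
    (hjpow : ∀ (t : E) (n : ℤ), Valued.v (jE t) = Valued.v (jE ϖ) ^ n ↔ Valued.v t = Valued.v ϖ ^ n)
    (hϖmax : ∀ t : M, ρ t = t → Valued.v t < 1 → Valued.v t ≤ Valued.v (jE ϖ))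
    (φ : (Fin 2 → E) →+ M) (hφs : ∀ (c : E) (x : Fin 2 → E), φ (c • x) = jE c * φ x) (hφi : Function.Injective φ) (hφo : Function.Surjective φ)
    {γ₂ : GL (Fin 2) E} {lam h : M} (hφγ : ∀ x, φ ((γ₂ : Matrix (Fin 2) (Fin 2) E).mulVec x) = lam * φ x) (hlam : Valued.v lam = 1)
    (hΘh : Θ h = h) (hh : h ≠ 0) (hform : ∀ x y, jE (pairing σ H₂ x y) = h * Θ (φ x) * φ y + ρ (h * Θ (φ x) * φ y))
    (u : E) {b : ℕ} (hb : 1 ≤ b) (hdb : d ≤ b) {j : ℕ} (hlamj : IsOrd ρ α (jE ϖ ^ j) lam)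
    (f : ℕ → ℕ → AddSubgroup M → ℕ)
    (hf : ∀ (b j : ℕ) (Λ : AddSubgroup M) (x₀ : M) (r : E), 1 ≤ b → x₀ ≠ 0 →
      (∀ x, x ∈ Λ ↔ ∃ z, IsOrd ρ α (jE ϖ ^ j) z ∧ x = x₀ * z) →
      IsOrd ρ α (jE ϖ ^ j) (dualGen ρ Θ α (jE ϖ ^ j) h x₀) → ¬ IsOrd ρ α (jE ϖ ^ j) (dualGen ρ Θ α (jE ϖ ^ j) h x₀ / jE ϖ) →
      Valued.v (dualGen ρ Θ α (jE ϖ ^ j) h x₀) = Valued.v (jE ϖ) ^ b →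
      (∀ b', (∀ x ∈ Λ, Valued.v (h * Θ x * b' + ρ (h * Θ x * b')) ≤ 1) → (lam - jE u) * b' ∈ Λ) →
      IsOrd ρ α (jE ϖ ^ j) lam → jE r = glueUnit ρ Θ α (jE ϖ ^ j) h (jE ϖ) (jE hW) x₀ b →
      f b j Λ = Nat.card {x : 𝒪[E] ⧸ 𝓂[E] ^ (2 * b) // ∃ u' : 𝒪[E], Ideal.Quotient.mk (𝓂[E] ^ (2 * b)) u' = x ∧
        Valued.v ((u' : E) * σ u' - r) ≤ Valued.v (ϖ ^ (2 * b))}) :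
    ∀ Λ ∈ levelSetDep ρ Θ α (jE ϖ) h j b (lam - jE u), f b j Λ = 2 * Nat.card 𝓀[E] ^ b ∨ f b j Λ = 0 := by
  intro Λ hΛ
  obtain ⟨-, r₀, -, -, -, -, -, -, hσr₀, hr₀1, -, hfΛ⟩ := exists_fixed_unit_weight_eq_natCard_normFibre σ hσ hvσ hϖ hH₂σ hhW hhWσ jE hρρ hvρ hα hα1 hint hΘΘ hΘρ hvΘ
    hΘj hjv hjfix hjpow hϖmax φ hφs hφi hφo hφγ hlam hΘh hh hform u hb hlamj f hf hΛ
  rw [hfΛ]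
  by_cases hN : ∃ z : E, z * σ z = r₀
  · exact Or.inl (natCard_normFibre_eq_two_mul_pow_of_exists hD h2v hr₀1 hN hdb)
  · exact Or.inr (natCard_normFibre_eq_zero_of_not_exists_of_le hD hσr₀ hr₀1 hN hdb)

/-- **(M4-hi) AT AND ABOVE THE CONDUCTOR EVERY LABELLED WEIGHT OF THE CELL IS `2q^b ·` THE LABELLED COUNT OF ITS POPULATED PART**:
`Σᶠ_{Λ ∈ cell ∩ {P}} f b j Λ = 2q^b · #{Λ ∈ cell ∣ P Λ ∧ f b j Λ ≠ 0}` for ANY label `P` (`1 ≤ b`, `d ≤ b`). [cite: Serre1979, Ch. V §3 Prop. 5, Cor. 2–3 pp. 84–86]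
[cite: Kottwitz1986BaseChangeUnits, §1 pp. 240–241] -/
theorem finsum_levelSetDep_inter_weight_eq_two_mul_pow_mul_ncard_of_le [CompleteSpace E] [IsDiscreteValuationRing 𝒪[E]] [Finite 𝓀[E]]
    (σ : E →+* E) (hσ : ∀ a, σ (σ a) = a) (hvσ : ∀ a, Valued.v (σ a) = Valued.v a)
    {ϖ : E} (hϖ : Valued.v ϖ = WithZero.exp (-1 : ℤ)) {d t : ℕ} (hD : IsRamifiedQuadraticDatum σ ϖ d t) (h2v : Valued.v (2 : E) < 1)
    {H₂ : Matrix (Fin 2) (Fin 2) E} (hH₂σ : (H₂.map σ)ᵀ = H₂) {hW : E} (hhW : Valued.v hW = 1) (hhWσ : σ hW = hW) (jE : E →+* M)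
    (hρρ : ∀ x, ρ (ρ x) = x) (hvρ : ∀ x, Valued.v (ρ x) = Valued.v x) (hα : ρ α ≠ α) (hα1 : Valued.v α ≤ 1)
    (hint : ∀ z : M, Valued.v z ≤ 1 → Valued.v ((z - ρ z) / (α - ρ α)) ≤ 1)
    (hΘΘ : ∀ x, Θ (Θ x) = x) (hΘρ : ∀ x, Θ (ρ x) = ρ (Θ x)) (hvΘ : ∀ x, Valued.v (Θ x) = Valued.v x) (hΘj : ∀ x, Θ (jE x) = jE (σ x))
    (hjv : ∀ c, Valued.v (jE c) ≤ 1 ↔ Valued.v c ≤ 1) (hjfix : ∀ z, ρ z = z ↔ ∃ c, jE c = z)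
    (hjpow : ∀ (t : E) (n : ℤ), Valued.v (jE t) = Valued.v (jE ϖ) ^ n ↔ Valued.v t = Valued.v ϖ ^ n)
    (hϖmax : ∀ t : M, ρ t = t → Valued.v t < 1 → Valued.v t ≤ Valued.v (jE ϖ))
    (φ : (Fin 2 → E) →+ M) (hφs : ∀ (c : E) (x : Fin 2 → E), φ (c • x) = jE c * φ x) (hφi : Function.Injective φ) (hφo : Function.Surjective φ)
    {γ₂ : GL (Fin 2) E} {lam h : M} (hφγ : ∀ x, φ ((γ₂ : Matrix (Fin 2) (Fin 2) E).mulVec x) = lam * φ x) (hlam : Valued.v lam = 1)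
    (hΘh : Θ h = h) (hh : h ≠ 0) (hform : ∀ x y, jE (pairing σ H₂ x y) = h * Θ (φ x) * φ y + ρ (h * Θ (φ x) * φ y))
    (u : E) {b : ℕ} (hb : 1 ≤ b) (hdb : d ≤ b) {j : ℕ} (hlamj : IsOrd ρ α (jE ϖ ^ j) lam)
    (f : ℕ → ℕ → AddSubgroup M → ℕ)
    (hf : ∀ (b j : ℕ) (Λ : AddSubgroup M) (x₀ : M) (r : E), 1 ≤ b → x₀ ≠ 0 →
      (∀ x, x ∈ Λ ↔ ∃ z, IsOrd ρ α (jE ϖ ^ j) z ∧ x = x₀ * z) →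
      IsOrd ρ α (jE ϖ ^ j) (dualGen ρ Θ α (jE ϖ ^ j) h x₀) → ¬ IsOrd ρ α (jE ϖ ^ j) (dualGen ρ Θ α (jE ϖ ^ j) h x₀ / jE ϖ) →
      Valued.v (dualGen ρ Θ α (jE ϖ ^ j) h x₀) = Valued.v (jE ϖ) ^ b →
      (∀ b', (∀ x ∈ Λ, Valued.v (h * Θ x * b' + ρ (h * Θ x * b')) ≤ 1) → (lam - jE u) * b' ∈ Λ) →
      IsOrd ρ α (jE ϖ ^ j) lam → jE r = glueUnit ρ Θ α (jE ϖ ^ j) h (jE ϖ) (jE hW) x₀ b →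
      f b j Λ = Nat.card {x : 𝒪[E] ⧸ 𝓂[E] ^ (2 * b) // ∃ u' : 𝒪[E], Ideal.Quotient.mk (𝓂[E] ^ (2 * b)) u' = x ∧
        Valued.v ((u' : E) * σ u' - r) ≤ Valued.v (ϖ ^ (2 * b))})
    (P : AddSubgroup M → Prop) :
    ∑ᶠ Λ ∈ levelSetDep ρ Θ α (jE ϖ) h j b (lam - jE u) ∩ {Λ | P Λ}, f b j Λ =
      2 * Nat.card 𝓀[E] ^ b * {Λ ∈ levelSetDep ρ Θ α (jE ϖ) h j b (lam - jE u) | P Λ ∧ f b j Λ ≠ 0}.ncard :=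
  finsum_mem_inter_eq_mul_ncard_of_eq_or_eq_zero _ (f b j) _
    (weight_eq_two_mul_pow_or_eq_zero_of_le σ hσ hvσ hϖ hD h2v hH₂σ hhW hhWσ jE hρρ hvρ hα hα1 hint hΘΘ hΘρ hvΘ hΘj hjv hjfix hjpow hϖmax
      φ hφs hφi hφo hφγ hlam hΘh hh hform u hb hdb hlamj f hf) P

/-- **HEAD-hi — (M4-hi) «AT AND ABOVE THE CONDUCTOR THE WEIGHTED FACE OF A TUBE CELL IS THE UNWEIGHTED BALANCE OF ITS POPULATED SUB-CELL»** (an `iff`; `1 ≤ b`, `d ≤ b`):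
`Σᶠ_{cell ∩ {P₁}} f b j = Σᶠ_{cell ∩ {Q₁}} f b j ↔ #{Λ ∈ cell ∣ P₁ Λ ∧ f b j Λ ≠ 0} = #{Λ ∈ cell ∣ Q₁ Λ ∧ f b j Λ ≠ 0}` (`2q^b ≠ 0`).  The right-hand side is what the
near-similitude torus flip of the HP-WITNESS-TABLE (rows `a₂ ≥ 2d`) delivers; it is NOT claimed here. [cite: Rogawski1990, §4.9 Prop. 4.9.1 (b) p. 55]
[cite: Serre1979, Ch. V §3 Prop. 5, Cor. 2–3 pp. 84–86] [cite: Kottwitz1986BaseChangeUnits, §1 pp. 240–241] -/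
theorem finsum_levelSetDep_inter_weight_eq_iff_of_le [CompleteSpace E] [IsDiscreteValuationRing 𝒪[E]] [Finite 𝓀[E]]
    (σ : E →+* E) (hσ : ∀ a, σ (σ a) = a) (hvσ : ∀ a, Valued.v (σ a) = Valued.v a)
    {ϖ : E} (hϖ : Valued.v ϖ = WithZero.exp (-1 : ℤ)) {d t : ℕ} (hD : IsRamifiedQuadraticDatum σ ϖ d t) (h2v : Valued.v (2 : E) < 1)
    {H₂ : Matrix (Fin 2) (Fin 2) E} (hH₂σ : (H₂.map σ)ᵀ = H₂) {hW : E} (hhW : Valued.v hW = 1) (hhWσ : σ hW = hW) (jE : E →+* M)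
    (hρρ : ∀ x, ρ (ρ x) = x) (hvρ : ∀ x, Valued.v (ρ x) = Valued.v x) (hα : ρ α ≠ α) (hα1 : Valued.v α ≤ 1)
    (hint : ∀ z : M, Valued.v z ≤ 1 → Valued.v ((z - ρ z) / (α - ρ α)) ≤ 1)
    (hΘΘ : ∀ x, Θ (Θ x) = x) (hΘρ : ∀ x, Θ (ρ x) = ρ (Θ x)) (hvΘ : ∀ x, Valued.v (Θ x) = Valued.v x) (hΘj : ∀ x, Θ (jE x) = jE (σ x))
    (hjv : ∀ c, Valued.v (jE c) ≤ 1 ↔ Valued.v c ≤ 1) (hjfix : ∀ z, ρ z = z ↔ ∃ c, jE c = z)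
    (hjpow : ∀ (t : E) (n : ℤ), Valued.v (jE t) = Valued.v (jE ϖ) ^ n ↔ Valued.v t = Valued.v ϖ ^ n)
    (hϖmax : ∀ t : M, ρ t = t → Valued.v t < 1 → Valued.v t ≤ Valued.v (jE ϖ))
    (φ : (Fin 2 → E) →+ M) (hφs : ∀ (c : E) (x : Fin 2 → E), φ (c • x) = jE c * φ x) (hφi : Function.Injective φ) (hφo : Function.Surjective φ)
    {γ₂ : GL (Fin 2) E} {lam h : M} (hφγ : ∀ x, φ ((γ₂ : Matrix (Fin 2) (Fin 2) E).mulVec x) = lam * φ x) (hlam : Valued.v lam = 1)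
    (hΘh : Θ h = h) (hh : h ≠ 0) (hform : ∀ x y, jE (pairing σ H₂ x y) = h * Θ (φ x) * φ y + ρ (h * Θ (φ x) * φ y))
    (u : E) {b : ℕ} (hb : 1 ≤ b) (hdb : d ≤ b) {j : ℕ} (hlamj : IsOrd ρ α (jE ϖ ^ j) lam)
    (f : ℕ → ℕ → AddSubgroup M → ℕ)
    (hf : ∀ (b j : ℕ) (Λ : AddSubgroup M) (x₀ : M) (r : E), 1 ≤ b → x₀ ≠ 0 →
      (∀ x, x ∈ Λ ↔ ∃ z, IsOrd ρ α (jE ϖ ^ j) z ∧ x = x₀ * z) →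
      IsOrd ρ α (jE ϖ ^ j) (dualGen ρ Θ α (jE ϖ ^ j) h x₀) → ¬ IsOrd ρ α (jE ϖ ^ j) (dualGen ρ Θ α (jE ϖ ^ j) h x₀ / jE ϖ) →
      Valued.v (dualGen ρ Θ α (jE ϖ ^ j) h x₀) = Valued.v (jE ϖ) ^ b →
      (∀ b', (∀ x ∈ Λ, Valued.v (h * Θ x * b' + ρ (h * Θ x * b')) ≤ 1) → (lam - jE u) * b' ∈ Λ) →
      IsOrd ρ α (jE ϖ ^ j) lam → jE r = glueUnit ρ Θ α (jE ϖ ^ j) h (jE ϖ) (jE hW) x₀ b →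
      f b j Λ = Nat.card {x : 𝒪[E] ⧸ 𝓂[E] ^ (2 * b) // ∃ u' : 𝒪[E], Ideal.Quotient.mk (𝓂[E] ^ (2 * b)) u' = x ∧
        Valued.v ((u' : E) * σ u' - r) ≤ Valued.v (ϖ ^ (2 * b))})
    (P₁ Q₁ : AddSubgroup M → Prop) :
    (∑ᶠ Λ ∈ levelSetDep ρ Θ α (jE ϖ) h j b (lam - jE u) ∩ {Λ | P₁ Λ}, f b j Λ =
        ∑ᶠ Λ ∈ levelSetDep ρ Θ α (jE ϖ) h j b (lam - jE u) ∩ {Λ | Q₁ Λ}, f b j Λ) ↔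
      {Λ ∈ levelSetDep ρ Θ α (jE ϖ) h j b (lam - jE u) | P₁ Λ ∧ f b j Λ ≠ 0}.ncard =
        {Λ ∈ levelSetDep ρ Θ α (jE ϖ) h j b (lam - jE u) | Q₁ Λ ∧ f b j Λ ≠ 0}.ncard := by
  haveI : Nonempty 𝓀[E] := ⟨0⟩
  have hq : 2 * Nat.card 𝓀[E] ^ b ≠ 0 := mul_ne_zero two_ne_zero (pow_ne_zero b Nat.card_pos.ne')
  rw [finsum_levelSetDep_inter_weight_eq_two_mul_pow_mul_ncard_of_le σ hσ hvσ hϖ hD h2v hH₂σ hhW hhWσ jE hρρ hvρ hα hα1 hint hΘΘ hΘρ hvΘ hΘj hjv hjfix hjpow hϖmax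
      φ hφs hφi hφo hφγ hlam hΘh hh hform u hb hdb hlamj f hf P₁,
    finsum_levelSetDep_inter_weight_eq_two_mul_pow_mul_ncard_of_le σ hσ hvσ hϖ hD h2v hH₂σ hhW hhWσ jE hρρ hvρ hα hα1 hint hΘΘ hΘρ hvΘ hΘj hjv hjfix hjpow hϖmax
      φ hφs hφi hφo hφγ hlam hΘh hh hform u hb hdb hlamj f hf Q₁]
  exact ⟨fun h' => Nat.eq_of_mul_eq_mul_left (Nat.pos_of_ne_zero hq) h', fun h' => by rw [h']⟩

/-- **SOCKET-hi — (M4-hi) «A POPULATEDNESS-PRESERVING, LABEL-EXCHANGING CELL SYMMETRY CLOSES THE WEIGHTED FACE AT AND ABOVE THE CONDUCTOR».**  For `1 ≤ b`, `d ≤ b` and any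
`τ : AddSubgroup M ≃ AddSubgroup M` preserving the cell `levelSetDep(j, b; lam − jE u)`, preserving POPULATEDNESS on it (`f b j (τ Λ) ≠ 0 ↔ f b j Λ ≠ 0`) and exchanging the labels
(`P₁ Λ → Q₁ (τ Λ)`, `Q₁ Λ → P₁ (τ⁻¹ Λ)`): `Σᶠ_{cell ∩ {P₁}} f b j = Σᶠ_{cell ∩ {Q₁}} f b j`.  (The intended `τ` is the near-similitude torus flip `Λ ↦ ε • Λ`, `ε·Θε = ν ∉ F` — cell
preservation by ★ p860839 ED. 2 `smul_mem_levelSetDep_iff_of_orderUnit`; its populatedness ∕ label transport is OPEN.  The EXACT ω-flip does NOT qualify: §3.)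
[cite: Rogawski1990, §4.9 Prop. 4.9.1 (b) p. 55] [cite: Serre1979, Ch. V §3 Prop. 5, Cor. 2–3 pp. 84–86] [cite: Kottwitz1986BaseChangeUnits, §1 pp. 240–241] -/
theorem finsum_levelSetDep_inter_weight_eq_of_popPreserving_exchange_of_le [CompleteSpace E] [IsDiscreteValuationRing 𝒪[E]] [Finite 𝓀[E]]
    (σ : E →+* E) (hσ : ∀ a, σ (σ a) = a) (hvσ : ∀ a, Valued.v (σ a) = Valued.v a)
    {ϖ : E} (hϖ : Valued.v ϖ = WithZero.exp (-1 : ℤ)) {d t : ℕ} (hD : IsRamifiedQuadraticDatum σ ϖ d t) (h2v : Valued.v (2 : E) < 1)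
    {H₂ : Matrix (Fin 2) (Fin 2) E} (hH₂σ : (H₂.map σ)ᵀ = H₂) {hW : E} (hhW : Valued.v hW = 1) (hhWσ : σ hW = hW) (jE : E →+* M)
    (hρρ : ∀ x, ρ (ρ x) = x) (hvρ : ∀ x, Valued.v (ρ x) = Valued.v x) (hα : ρ α ≠ α) (hα1 : Valued.v α ≤ 1)
    (hint : ∀ z : M, Valued.v z ≤ 1 → Valued.v ((z - ρ z) / (α - ρ α)) ≤ 1)
    (hΘΘ : ∀ x, Θ (Θ x) = x) (hΘρ : ∀ x, Θ (ρ x) = ρ (Θ x)) (hvΘ : ∀ x, Valued.v (Θ x) = Valued.v x) (hΘj : ∀ x, Θ (jE x) = jE (σ x))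
    (hjv : ∀ c, Valued.v (jE c) ≤ 1 ↔ Valued.v c ≤ 1) (hjfix : ∀ z, ρ z = z ↔ ∃ c, jE c = z)
    (hjpow : ∀ (t : E) (n : ℤ), Valued.v (jE t) = Valued.v (jE ϖ) ^ n ↔ Valued.v t = Valued.v ϖ ^ n)
    (hϖmax : ∀ t : M, ρ t = t → Valued.v t < 1 → Valued.v t ≤ Valued.v (jE ϖ))
    (φ : (Fin 2 → E) →+ M) (hφs : ∀ (c : E) (x : Fin 2 → E), φ (c • x) = jE c * φ x) (hφi : Function.Injective φ) (hφo : Function.Surjective φ)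
    {γ₂ : GL (Fin 2) E} {lam h : M} (hφγ : ∀ x, φ ((γ₂ : Matrix (Fin 2) (Fin 2) E).mulVec x) = lam * φ x) (hlam : Valued.v lam = 1)
    (hΘh : Θ h = h) (hh : h ≠ 0) (hform : ∀ x y, jE (pairing σ H₂ x y) = h * Θ (φ x) * φ y + ρ (h * Θ (φ x) * φ y))
    (u : E) {b : ℕ} (hb : 1 ≤ b) (hdb : d ≤ b) {j : ℕ} (hlamj : IsOrd ρ α (jE ϖ ^ j) lam)
    (f : ℕ → ℕ → AddSubgroup M → ℕ)
    (hf : ∀ (b j : ℕ) (Λ : AddSubgroup M) (x₀ : M) (r : E), 1 ≤ b → x₀ ≠ 0 →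
      (∀ x, x ∈ Λ ↔ ∃ z, IsOrd ρ α (jE ϖ ^ j) z ∧ x = x₀ * z) →
      IsOrd ρ α (jE ϖ ^ j) (dualGen ρ Θ α (jE ϖ ^ j) h x₀) → ¬ IsOrd ρ α (jE ϖ ^ j) (dualGen ρ Θ α (jE ϖ ^ j) h x₀ / jE ϖ) →
      Valued.v (dualGen ρ Θ α (jE ϖ ^ j) h x₀) = Valued.v (jE ϖ) ^ b →
      (∀ b', (∀ x ∈ Λ, Valued.v (h * Θ x * b' + ρ (h * Θ x * b')) ≤ 1) → (lam - jE u) * b' ∈ Λ) →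
      IsOrd ρ α (jE ϖ ^ j) lam → jE r = glueUnit ρ Θ α (jE ϖ ^ j) h (jE ϖ) (jE hW) x₀ b →
      f b j Λ = Nat.card {x : 𝒪[E] ⧸ 𝓂[E] ^ (2 * b) // ∃ u' : 𝒪[E], Ideal.Quotient.mk (𝓂[E] ^ (2 * b)) u' = x ∧
        Valued.v ((u' : E) * σ u' - r) ≤ Valued.v (ϖ ^ (2 * b))})
    (τ : AddSubgroup M ≃ AddSubgroup M) (hτ : ∀ Λ, τ Λ ∈ levelSetDep ρ Θ α (jE ϖ) h j b (lam - jE u) ↔ Λ ∈ levelSetDep ρ Θ α (jE ϖ) h j b (lam - jE u))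
    (hpop : ∀ Λ ∈ levelSetDep ρ Θ α (jE ϖ) h j b (lam - jE u), f b j (τ Λ) ≠ 0 ↔ f b j Λ ≠ 0) (P₁ Q₁ : AddSubgroup M → Prop)
    (hPQ : ∀ Λ ∈ levelSetDep ρ Θ α (jE ϖ) h j b (lam - jE u), P₁ Λ → Q₁ (τ Λ)) (hQP : ∀ Λ ∈ levelSetDep ρ Θ α (jE ϖ) h j b (lam - jE u), Q₁ Λ → P₁ (τ.symm Λ)) :
    ∑ᶠ Λ ∈ levelSetDep ρ Θ α (jE ϖ) h j b (lam - jE u) ∩ {Λ | P₁ Λ}, f b j Λ =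
      ∑ᶠ Λ ∈ levelSetDep ρ Θ α (jE ϖ) h j b (lam - jE u) ∩ {Λ | Q₁ Λ}, f b j Λ :=
  finsum_mem_inter_eq_of_equiv_exchange_of_eq_or_eq_zero _ τ hτ (f b j) _
    (weight_eq_two_mul_pow_or_eq_zero_of_le σ hσ hvσ hϖ hD h2v hH₂σ hhW hhWσ jE hρρ hvρ hα hα1 hint hΘΘ hΘρ hvΘ hΘj hjv hjfix hjpow hϖmax
      φ hφs hφi hφo hφγ hlam hΘh hh hform u hb hdb hlamj f hf) hpop P₁ Q₁ hPQ hQP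

/-! ## §3 TIGHTNESS: the exact ω-flip reverses populatedness at and above the conductor -/

/-- **TIGHTNESS — (M4-hi) «THE EXACT ω-FLIP REVERSES POPULATEDNESS AT AND ABOVE THE CONDUCTOR».**  For the flip unit `z` of ★ `ConeWeightHalfSplit` (`|z| = 1`, `z·Θz = jE ξ`,
`ξ` a `σ`-fixed NON-norm of `E`) and `Λ ∈ levelSetDep(j, b; lam − jE u)` with `1 ≤ b`, `d ≤ b`: `f b j (z • Λ) ≠ 0 ↔ f b j Λ = 0` — the cell member's glue unit `r₀` goes to `r₀∕ξ`
(★ `glueUnit_mul_left`), and exactly one of `r₀`, `r₀∕ξ` is a norm (★ `isNorm_iff_not_isNorm_div`), so exactly one of the two weights is `2q^b` and the other `0` (★ T1).  Hence on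
an ω-cell at∕above the conductor the exact ω-flip CANNOT be the populatedness-preserving involution (LH4-p09 (g9) 14:43:32Z caveat; HP-WITNESS-TABLE: (W1)–(W3) are admissible only
below it). [cite: LabesseLanglands1979, §2 p. 8] [cite: Serre1979, Ch. V §3 Prop. 5, Cor. 2–3 pp. 84–86] [cite: Jacobowitz1962, §4] -/
theorem weight_smul_ne_zero_iff_weight_eq_zero_of_le [CompleteSpace E] [IsDiscreteValuationRing 𝒪[E]] [Finite 𝓀[E]]
    (σ : E →+* E) (hσ : ∀ a, σ (σ a) = a) (hvσ : ∀ a, Valued.v (σ a) = Valued.v a)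
    {ϖ : E} (hϖ : Valued.v ϖ = WithZero.exp (-1 : ℤ)) {d t : ℕ} (hD : IsRamifiedQuadraticDatum σ ϖ d t) (h2v : Valued.v (2 : E) < 1)
    {H₂ : Matrix (Fin 2) (Fin 2) E} (hH₂σ : (H₂.map σ)ᵀ = H₂) {hW : E} (hhW : Valued.v hW = 1) (hhWσ : σ hW = hW) (jE : E →+* M)
    (hρρ : ∀ x, ρ (ρ x) = x) (hvρ : ∀ x, Valued.v (ρ x) = Valued.v x) (hα : ρ α ≠ α) (hα1 : Valued.v α ≤ 1)
    (hint : ∀ z : M, Valued.v z ≤ 1 → Valued.v ((z - ρ z) / (α - ρ α)) ≤ 1)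
    (hΘΘ : ∀ x, Θ (Θ x) = x) (hΘρ : ∀ x, Θ (ρ x) = ρ (Θ x)) (hvΘ : ∀ x, Valued.v (Θ x) = Valued.v x) (hΘj : ∀ x, Θ (jE x) = jE (σ x))
    (hjv : ∀ c, Valued.v (jE c) ≤ 1 ↔ Valued.v c ≤ 1) (hjfix : ∀ z, ρ z = z ↔ ∃ c, jE c = z)
    (hjpow : ∀ (t : E) (n : ℤ), Valued.v (jE t) = Valued.v (jE ϖ) ^ n ↔ Valued.v t = Valued.v ϖ ^ n)
    (hϖmax : ∀ t : M, ρ t = t → Valued.v t < 1 → Valued.v t ≤ Valued.v (jE ϖ))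
    (φ : (Fin 2 → E) →+ M) (hφs : ∀ (c : E) (x : Fin 2 → E), φ (c • x) = jE c * φ x) (hφi : Function.Injective φ) (hφo : Function.Surjective φ)
    {γ₂ : GL (Fin 2) E} {lam h : M} (hφγ : ∀ x, φ ((γ₂ : Matrix (Fin 2) (Fin 2) E).mulVec x) = lam * φ x) (hlam : Valued.v lam = 1)
    (hΘh : Θ h = h) (hh : h ≠ 0) (hform : ∀ x y, jE (pairing σ H₂ x y) = h * Θ (φ x) * φ y + ρ (h * Θ (φ x) * φ y))
    (z : M) (hz1 : Valued.v z = 1) (ξ : E) (hzξ : z * Θ z = jE ξ) (hσξ : σ ξ = ξ) (hξN : ¬ ∃ e : E, e * σ e = ξ)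
    (u : E) {b : ℕ} (hb : 1 ≤ b) (hdb : d ≤ b) {j : ℕ} (hlamj : IsOrd ρ α (jE ϖ ^ j) lam)
    (f : ℕ → ℕ → AddSubgroup M → ℕ)
    (hf : ∀ (b j : ℕ) (Λ : AddSubgroup M) (x₀ : M) (r : E), 1 ≤ b → x₀ ≠ 0 →
      (∀ x, x ∈ Λ ↔ ∃ z, IsOrd ρ α (jE ϖ ^ j) z ∧ x = x₀ * z) →
      IsOrd ρ α (jE ϖ ^ j) (dualGen ρ Θ α (jE ϖ ^ j) h x₀) → ¬ IsOrd ρ α (jE ϖ ^ j) (dualGen ρ Θ α (jE ϖ ^ j) h x₀ / jE ϖ) →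
      Valued.v (dualGen ρ Θ α (jE ϖ ^ j) h x₀) = Valued.v (jE ϖ) ^ b →
      (∀ b', (∀ x ∈ Λ, Valued.v (h * Θ x * b' + ρ (h * Θ x * b')) ≤ 1) → (lam - jE u) * b' ∈ Λ) →
      IsOrd ρ α (jE ϖ ^ j) lam → jE r = glueUnit ρ Θ α (jE ϖ ^ j) h (jE ϖ) (jE hW) x₀ b →
      f b j Λ = Nat.card {x : 𝒪[E] ⧸ 𝓂[E] ^ (2 * b) // ∃ u' : 𝒪[E], Ideal.Quotient.mk (𝓂[E] ^ (2 * b)) u' = x ∧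
        Valued.v ((u' : E) * σ u' - r) ≤ Valued.v (ϖ ^ (2 * b))})
    {Λ : AddSubgroup M} (hΛ : Λ ∈ levelSetDep ρ Θ α (jE ϖ) h j b (lam - jE u)) :
    f b j (z • Λ) ≠ 0 ↔ f b j Λ = 0 := by
  haveI : Nonempty 𝓀[E] := ⟨0⟩
  have hq : 2 * Nat.card 𝓀[E] ^ b ≠ 0 := mul_ne_zero two_ne_zero (pow_ne_zero b Nat.card_pos.ne')
  have hvϖ0 : Valued.v ϖ ≠ 0 := by rw [hϖ]; exact WithZero.exp_ne_zero
  have hϖ0 : ϖ ≠ 0 := fun h0 => by rw [h0, map_zero] at hvϖ0; exact hvϖ0 rfl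
  have hϖ1 : Valued.v ϖ < 1 := by rw [hϖ, ← WithZero.exp_zero, WithZero.exp_lt_exp]; norm_num
  have hρϖ : ρ (jE ϖ) = jE ϖ := (hjfix (jE ϖ)).2 ⟨ϖ, rfl⟩
  have hϖE0 : jE ϖ ≠ 0 := (map_ne_zero jE).2 hϖ0
  have hc : ρ (jE ϖ ^ j) = jE ϖ ^ j := by rw [map_pow, hρϖ]
  have hc0 : jE ϖ ^ j ≠ 0 := pow_ne_zero j hϖE0
  have hc1 : Valued.v (jE ϖ ^ j) ≤ 1 := by rw [map_pow]; exact pow_le_one₀ zero_le ((hjv ϖ).2 hϖ1.le)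
  have hd0 : α - ρ α ≠ 0 := sub_ne_zero.2 (Ne.symm hα)
  -- the flip unit
  have hρξ' : ρ (jE ξ) = jE ξ := (hjfix (jE ξ)).2 ⟨ξ, rfl⟩
  have hξ'1 : Valued.v (jE ξ) = 1 := by rw [← hzξ, map_mul, hvΘ, hz1, one_mul]
  have hξ'0 : jE ξ ≠ 0 := fun h0 => by rw [h0, map_zero] at hξ'1; exact zero_ne_one hξ'1
  have hξ1 : Valued.v ξ = 1 := by
    have := (hjpow ξ 0).1 (by rw [zpow_zero]; exact hξ'1)
    rwa [zpow_zero] at this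
  have hz0 : z ≠ 0 := fun h0 => by rw [h0, map_zero] at hz1; exact zero_ne_one hz1
  -- the cell member, its canonical cone datum `r₀`, and the flipped member presented by `z·x₀` carrying `r₀ ∕ ξ`
  obtain ⟨x₀, r₀, hx₀, hΛx, hyO, hyprim, hylev, hdepΛ, hσr₀, hr₀1, hr₀, hfΛ⟩ := exists_fixed_unit_weight_eq_natCard_normFibre σ hσ hvσ hϖ hH₂σ hhW hhWσ jE hρρ hvρ hα
    hα1 hint hΘΘ hΘρ hvΘ hΘj hjv hjfix hjpow hϖmax φ hφs hφi hφo hφγ hlam hΘh hh hform u hb hlamj f hf hΛ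
  have hr₀0 : r₀ ≠ 0 := fun h0 => by rw [h0, map_zero] at hr₀1; exact zero_ne_one hr₀1
  have hσr₀' : σ (r₀ / ξ) = r₀ / ξ := by rw [map_div₀, hσr₀, hσξ]
  have hr₀'1 : Valued.v (r₀ / ξ) = 1 := by rw [map_div₀, hr₀1, hξ1, div_one]
  obtain ⟨hzx₀, hΛ'x, hyO', hyprim', hylev', hdep'⟩ :=
    cell_clauses_map_mulLeft hρρ hvρ hα hα1 hint hΘΘ hΘρ hvΘ hc hc0 hc1 hh hz0 hzξ hρξ' hξ'1 (jE ϖ) (lam - jE u) b hx₀ hΛx hyO hyprim hylev hdepΛ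
  have hY0 : dualGen ρ Θ α (jE ϖ ^ j) h x₀ ≠ 0 := by
    rw [dualGen_def]; exact mul_ne_zero (mul_ne_zero hh (mul_ne_zero hx₀ ((map_ne_zero Θ).2 hx₀))) (mul_ne_zero hc0 hd0)
  have hr₀' : jE (r₀ / ξ) = glueUnit ρ Θ α (jE ϖ ^ j) h (jE ϖ) (jE hW) (z * x₀) b := by rw [map_div₀, hr₀, glueUnit_mul_left hΘΘ hzξ hρξ' hξ'0 hY0]
  have hfzΛ : f b j (z • Λ) = Nat.card {x : 𝒪[E] ⧸ 𝓂[E] ^ (2 * b) // ∃ u' : 𝒪[E], Ideal.Quotient.mk (𝓂[E] ^ (2 * b)) u' = x ∧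
      Valued.v ((u' : E) * σ u' - r₀ / ξ) ≤ Valued.v (ϖ ^ (2 * b))} := by
    rw [pointwise_smul_eq_map_mulLeft]; exact hf b j _ (z * x₀) (r₀ / ξ) hb hzx₀ hΛ'x hyO' hyprim' hylev' hdep' hlamj hr₀'
  -- exactly one of `r₀`, `r₀ ∕ ξ` is a norm
  rw [hfΛ, hfzΛ]
  by_cases hN : ∃ e : E, e * σ e = r₀
  · have hN' : ¬ ∃ e : E, e * σ e = r₀ / ξ := (isNorm_iff_not_isNorm_div hD hσr₀ hr₀0 hσξ hξN).1 hN
    rw [natCard_normFibre_eq_two_mul_pow_of_exists hD h2v hr₀1 hN hdb, natCard_normFibre_eq_zero_of_not_exists_of_le hD hσr₀' hr₀'1 hN' hdb]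
    exact ⟨fun h0 => absurd rfl h0, fun h0 => absurd h0 hq⟩
  · have hN' : ∃ e : E, e * σ e = r₀ / ξ := by
      by_contra h'; exact hN ((isNorm_iff_not_isNorm_div hD hσr₀ hr₀0 hσξ hξN).2 h')
    rw [natCard_normFibre_eq_zero_of_not_exists_of_le hD hσr₀ hr₀1 hN hdb, natCard_normFibre_eq_two_mul_pow_of_exists hD h2v hr₀'1 hN' hdb]
    exact ⟨fun _ => rfl, fun _ => hq⟩

/-- **WHAT AN EXACT ω-FACE GIVES AT AND ABOVE THE CONDUCTOR: `#{cell ∣ P₁ ∧ pop} = #{cell ∣ Q₁ ∧ ¬pop}`** — the flip unit `z` of ★ `ConeWeightHalfSplit` exchanges the labels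
(`hPQ`, `hQP`) and REVERSES populatedness (`weight_smul_ne_zero_iff_weight_eq_zero_of_le`), so it pairs the populated `P₁`-part with the UNpopulated `Q₁`-part of the cell — not with
its populated `Q₁`-part: the weighted (β₂-H) face at `d ≤ b` is NOT a consequence of the exact ω-face. [cite: Rogawski1990, §4.9 Prop. 4.9.1 (b) p. 55]
[cite: LabesseLanglands1979, §2 p. 8] [cite: Kottwitz1986BaseChangeUnits, §1 pp. 240–241] -/
theorem ncard_sep_pop_eq_ncard_sep_unpop_of_flip_exchange_of_le [CompleteSpace E] [IsDiscreteValuationRing 𝒪[E]] [Finite 𝓀[E]]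
    (σ : E →+* E) (hσ : ∀ a, σ (σ a) = a) (hvσ : ∀ a, Valued.v (σ a) = Valued.v a)
    {ϖ : E} (hϖ : Valued.v ϖ = WithZero.exp (-1 : ℤ)) {d t : ℕ} (hD : IsRamifiedQuadraticDatum σ ϖ d t) (h2v : Valued.v (2 : E) < 1)
    {H₂ : Matrix (Fin 2) (Fin 2) E} (hH₂σ : (H₂.map σ)ᵀ = H₂) {hW : E} (hhW : Valued.v hW = 1) (hhWσ : σ hW = hW) (jE : E →+* M)
    (hρρ : ∀ x, ρ (ρ x) = x) (hvρ : ∀ x, Valued.v (ρ x) = Valued.v x) (hα : ρ α ≠ α) (hα1 : Valued.v α ≤ 1)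
    (hint : ∀ z : M, Valued.v z ≤ 1 → Valued.v ((z - ρ z) / (α - ρ α)) ≤ 1)
    (hΘΘ : ∀ x, Θ (Θ x) = x) (hΘρ : ∀ x, Θ (ρ x) = ρ (Θ x)) (hvΘ : ∀ x, Valued.v (Θ x) = Valued.v x) (hΘj : ∀ x, Θ (jE x) = jE (σ x))
    (hjv : ∀ c, Valued.v (jE c) ≤ 1 ↔ Valued.v c ≤ 1) (hjfix : ∀ z, ρ z = z ↔ ∃ c, jE c = z)
    (hjpow : ∀ (t : E) (n : ℤ), Valued.v (jE t) = Valued.v (jE ϖ) ^ n ↔ Valued.v t = Valued.v ϖ ^ n)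
    (hϖmax : ∀ t : M, ρ t = t → Valued.v t < 1 → Valued.v t ≤ Valued.v (jE ϖ))
    (φ : (Fin 2 → E) →+ M) (hφs : ∀ (c : E) (x : Fin 2 → E), φ (c • x) = jE c * φ x) (hφi : Function.Injective φ) (hφo : Function.Surjective φ)
    {γ₂ : GL (Fin 2) E} {lam h : M} (hφγ : ∀ x, φ ((γ₂ : Matrix (Fin 2) (Fin 2) E).mulVec x) = lam * φ x) (hlam : Valued.v lam = 1)
    (hΘh : Θ h = h) (hh : h ≠ 0) (hform : ∀ x y, jE (pairing σ H₂ x y) = h * Θ (φ x) * φ y + ρ (h * Θ (φ x) * φ y))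
    (z : M) (hz1 : Valued.v z = 1) (ξ : E) (hzξ : z * Θ z = jE ξ) (hσξ : σ ξ = ξ) (hξN : ¬ ∃ e : E, e * σ e = ξ)
    (u : E) {b : ℕ} (hb : 1 ≤ b) (hdb : d ≤ b) {j : ℕ} (hlamj : IsOrd ρ α (jE ϖ ^ j) lam)
    (f : ℕ → ℕ → AddSubgroup M → ℕ)
    (hf : ∀ (b j : ℕ) (Λ : AddSubgroup M) (x₀ : M) (r : E), 1 ≤ b → x₀ ≠ 0 →
      (∀ x, x ∈ Λ ↔ ∃ z, IsOrd ρ α (jE ϖ ^ j) z ∧ x = x₀ * z) →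
      IsOrd ρ α (jE ϖ ^ j) (dualGen ρ Θ α (jE ϖ ^ j) h x₀) → ¬ IsOrd ρ α (jE ϖ ^ j) (dualGen ρ Θ α (jE ϖ ^ j) h x₀ / jE ϖ) →
      Valued.v (dualGen ρ Θ α (jE ϖ ^ j) h x₀) = Valued.v (jE ϖ) ^ b →
      (∀ b', (∀ x ∈ Λ, Valued.v (h * Θ x * b' + ρ (h * Θ x * b')) ≤ 1) → (lam - jE u) * b' ∈ Λ) →
      IsOrd ρ α (jE ϖ ^ j) lam → jE r = glueUnit ρ Θ α (jE ϖ ^ j) h (jE ϖ) (jE hW) x₀ b →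
      f b j Λ = Nat.card {x : 𝒪[E] ⧸ 𝓂[E] ^ (2 * b) // ∃ u' : 𝒪[E], Ideal.Quotient.mk (𝓂[E] ^ (2 * b)) u' = x ∧
        Valued.v ((u' : E) * σ u' - r) ≤ Valued.v (ϖ ^ (2 * b))})
    (P₁ Q₁ : AddSubgroup M → Prop)
    (hPQ : ∀ Λ ∈ levelSetDep ρ Θ α (jE ϖ) h j b (lam - jE u), P₁ Λ → Q₁ (z • Λ))
    (hQP : ∀ Λ ∈ levelSetDep ρ Θ α (jE ϖ) h j b (lam - jE u), Q₁ Λ → P₁ (z⁻¹ • Λ)) :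
    {Λ ∈ levelSetDep ρ Θ α (jE ϖ) h j b (lam - jE u) | P₁ Λ ∧ f b j Λ ≠ 0}.ncard =
      {Λ ∈ levelSetDep ρ Θ α (jE ϖ) h j b (lam - jE u) | Q₁ Λ ∧ f b j Λ = 0}.ncard := by
  -- the flip letters in the `ε • Λ` currency of ★ p860839
  set ξ' : M := jE ξ with hξ'def
  have hρξ' : ρ ξ' = ξ' := (hjfix ξ').2 ⟨ξ, rfl⟩
  have hξ'1 : Valued.v ξ' = 1 := by rw [← hzξ, map_mul, hvΘ, hz1, one_mul]
  have hξ'0 : ξ' ≠ 0 := fun h0 => by rw [h0, map_zero] at hξ'1; exact zero_ne_one hξ'1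
  have hz0 : z ≠ 0 := ne_zero_of_mul_map_eq hzξ hξ'0
  have hpop : ∀ Λ ∈ levelSetDep ρ Θ α (jE ϖ) h j b (lam - jE u), f b j (z • Λ) ≠ 0 ↔ f b j Λ = 0 := fun Λ hΛ =>
    weight_smul_ne_zero_iff_weight_eq_zero_of_le σ hσ hvσ hϖ hD h2v hH₂σ hhW hhWσ jE hρρ hvρ hα hα1 hint hΘΘ hΘρ hvΘ hΘj hjv hjfix hjpow hϖmax
      φ hφs hφi hφo hφγ hlam hΘh hh hform z hz1 ξ hzξ hσξ hξN u hb hdb hlamj f hf hΛ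
  let τ : AddSubgroup M ≃ AddSubgroup M :=
    ⟨fun Λ => z • Λ, fun Λ => z⁻¹ • Λ, fun Λ => by simp only [smul_smul, inv_mul_cancel₀ hz0, one_smul],
      fun Λ => by simp only [smul_smul, mul_inv_cancel₀ hz0, one_smul]⟩
  have hτ : ∀ Λ, τ Λ ∈ levelSetDep ρ Θ α (jE ϖ) h j b (lam - jE u) ↔ Λ ∈ levelSetDep ρ Θ α (jE ϖ) h j b (lam - jE u) := fun Λ =>
    smul_mem_levelSetDep_iff_of_flip hzξ hρξ' hξ'1 (jE ϖ) h j b (lam - jE u) Λ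
  refine ncard_sep_eq_ncard_sep_of_equiv _ τ hτ (fun Λ => P₁ Λ ∧ f b j Λ ≠ 0) (fun Λ => Q₁ Λ ∧ f b j Λ = 0)
    (fun Λ hΛ hP => ⟨hPQ Λ hΛ hP.1, ?_⟩) (fun Λ hΛ hQ => ⟨hQP Λ hΛ hQ.1, ?_⟩)
  · -- `f (z • Λ) = 0` since `f Λ ≠ 0`
    by_contra hne
    exact hP.2 ((hpop Λ hΛ).1 hne)
  · -- `f (z⁻¹ • Λ) ≠ 0` since `f Λ = f (z • (z⁻¹ • Λ)) = 0`
    have hΛ' : z⁻¹ • Λ ∈ levelSetDep ρ Θ α (jE ϖ) h j b (lam - jE u) := by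
      have := (hτ (z⁻¹ • Λ)); rw [show τ (z⁻¹ • Λ) = Λ from τ.apply_symm_apply Λ] at this; exact this.1 hΛ
    intro h0
    have h1 : f b j (z • (z⁻¹ • Λ)) ≠ 0 := fun h2 => by
      have := (hpop (z⁻¹ • Λ) hΛ').2 h0
      exact this h2
    rw [smul_smul, mul_inv_cancel₀ hz0, one_smul] at h1
    exact h1 hQ.2

end Weight

end Summit.HodgeConjecture.HodgeConjecture.Cruxes.H413.F0P3cDyRamConeCellFaceTubeAbove

end
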